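import Mathlib.MeasureTheory.Integral.IntervalIntegral.FundThmCalculus
import Mathlib.MeasureTheory.Integral.DominatedConvergence
import Mathlib.Algebra.Polynomial.Bivariate
import Mathlib.Algebra.Polynomial.Roots
import Mathlib.Analysis.Calculus.Deriv.Polynomial
import Mathlib.Analysis.SpecialFunctions.Log.Deriv
import Mathlib.Topology.Algebra.MvPolynomial
import Mathlib.Order.Interval.Set.Infinite
import Literature.NumberTheory.Transcendental.SemialgebraicMaps
import Literature.NumberTheory.Transcendental.KZCalculus
import HarnessLib

/-!
# Barrier: primitives of algebraic functions are transcendental (Ayoub's Remark 1.2)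

Topic `Literature/Barriers/KontsevichZagierPeriods` (D-0021 barrier catalogue for the summit
`KontsevichZagierPeriods`; found while sourcing the seeds). An obstruction to one *proof
strategy* for Conjecture 1, not a no-go for the conjecture.

## What is printed

Ayoub states the compact form of the conjecture — **Conjecture 1.1** [Ayoub2015]: for `k` a number
field, the kernel of `∫_{[0,1]^∞} : 𝒪_{k-alg}(𝔻̄^∞) → ℂ` (power series algebraic over
`k(z₁, …, zₙ)`, convergent on a neighbourhood of the closed polydisc, `n` varying) is the
`k`-subspace spanned by the elements `∂g/∂zᵢ − g|_{zᵢ=1} + g|_{zᵢ=0}` — equivalent to the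
Kontsevich–Zagier conjecture (loc. cit. Fait 1.4, [Fresan2024, Conj. 3.5]), and remarks
[Ayoub2015, Rem. 1.2] (= [Fresan2024, Rem. 3.6]):

* *"sa version holomorphe est vraie pour une raison plutôt triviale"*: for **all** holomorphic
  functions the kernel is generated by these elements — induct on `n`, take a primitive `g` of `f`
  in the last variable, so that `h = f − (∂g/∂zₙ − g|_{zₙ=1} + g|_{zₙ=0})` is in the kernel and
  depends on `n − 1` variables only;
* *"le raisonnement ci-dessus ne peut pas fonctionner dans le cas algébrique pour la raison
  simple mais fondamentale : une primitive d'une fonction algébrique est en général une fonction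
  transcendante"*; Fresán: *"c'est déjà le cas pour la fonction `1/(z − 2)`"* [Fresan2024, Rem. 3.6];
* *"la Conjecture 1.1 a peu de chance d'être vraie si l'on fixe le nombre de variables à
  l'avance … il est probablement nécessaire d'utiliser des fonctions `g` qui dépendent de plus de
  `n + 1` variables"* [Ayoub2015, Rem. 1.2]; indeed the change of variables in **one** variable is
  recovered from the Stokes elements only with **two** variables [Ayoub2015, Rem. 1.5]
  [Fresan2024, Rem. 3.7].

Cresson–Viu-Sos print the same obstruction for the strategy "replace Stokes' formula by Fubini's
theorem and the Newton–Leibniz formula": *"this strategy can not be achieved for at least two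
reasons. First, primitives of algebraic functions are in general transcendental functions. As a
consequence, the integral representations obtained by Fubini's theorem are out of the algebraic
class. … Secondly, in the case where Fubini's theorem gives an integral in the algebraic class …
this induces potential quadratic relations between periods."* [CressonViusos2022, §2.1].

In the H21 calculus the same constraint is built into rule 3): the primitive `F` of a
Newton–Leibniz move must be `ℚ`-semialgebraic on the band (`Literature.NumberTheory.Transcendental.KZ.newtonLeibnizRel`).

## What is vendored

* `kernel_intervalIntegral_eq_stokes` (proved): the one-variable, real-continuous case of the
  "trivial" holomorphic mechanism — every continuous `f` with `∫₀¹ f = 0` **is** a Stokes element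
  `g' − (g 1 − g 0)` with `g 1 − g 0 = 0`, for the primitive `g x = ∫₀ˣ f`;
* `noSemialgebraicPrimitive_inv_sub_two` (named fact, BARRIER block): the real-variable
  transcription of "`1/(z − 2)` has no primitive in `𝒪_{ℚ-alg}(𝔻̄¹)`" — no `ℚ`-semialgebraic
  function on `[0, 1]` has derivative `1/(t − 2)` on `(0, 1)` (any such is `log (2 − t) + C`, and
  `log` is transcendental over `ℚ(t)`);
* `noSemialgebraicPrimitive_inv_sub_two_holds` (proved, this file): the named fact holds. The
  proof is elementary and self-contained (no Tarski–Seidenberg, no Puiseux theory): (A) by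
  induction over the Boolean algebra generated by the sets `{p = 0}`, `{p > 0}`, every
  `ℚ`-semialgebraic `S ⊆ ℝ²` is open and closed off the zero set of some real polynomial `q ≠ 0`
  (`NoSemialgPrim.exists_ne_zero_isOpen`); (B) a graph has empty interior, so the graph of `F`
  lies in `{q = 0}`, i.e. `P(t, F t) = 0` on `[0, 1]` for `P ≠ 0` in `ℝ[X][Y]`; (C) no function
  with derivative `1/(t − 2)` on `(0, 1)` satisfies such a relation
  (`NoSemialgPrim.eq_zero_of_evalEval_eq_zero`): by descent on `deg_Y P`, differentiating the
  relation along the curve and eliminating the top coefficient produces a relation of smaller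
  degree, whence the coefficient identity `(X − 2)(p_d p_{d−1}' − p_d' p_{d−1}) + d·p_d² = 0`,
  which (D) is impossible by comparing orders of vanishing at `X = 2`
  (`NoSemialgPrim.coeff_identity_ne_zero`) — the polynomial shadow of "`log` has a logarithmic
  singularity, rational functions do not".
* `algebraicPrimitivesObstructionNarrow` (named fact, NARROW BARRIER block; barrier audit
  2026-08-15) with `algebraicPrimitivesObstructionNarrow_holds`, `integral_kernelElt_eq_zero`,
  `kernelElt_not_stokes_one_variable` (all proved, this file): the KERNEL-ELEMENT form of the
  obstruction. `f(t) = 2t/(2 − t²) − 1/(2 − t)` — the change of variables `u(z) = z²` applied to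
  Fresán's `φ(z) = 1/(2 − z)`, `f = u'·φ∘u − φ`, poles `2, ±√2` outside the closed unit disc — has
  `∫₀¹ f = 0`, and for no real constant `c` does `f + c` admit a `ℚ`-semialgebraic primitive on
  `[0, 1]`; hence `f` is a kernel element of `𝒪_{ℚ-alg}(𝔻̄¹)` which is not a one-variable Stokes
  element `g' − (g(1) − g(0))` — the inductive step of the holomorphic proof fails on an element of
  the kernel (the old integrand `1/(t − 2)` is not one: `∫₀¹ dt/(t − 2) = −log 2`), and level
  `n = 1` of Ayoub's heuristic "plus de `n + 1` variables" is settled: one variable does not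
  suffice, two do [Ayoub2015, Rem. 1.5] [Fresan2024, Rem. 3.7] (printed for exactly this shape
  `u' f(u) − f`, `u(0) = 0`, `u(1) = 1`). The proof generalises steps (C)–(D) to derivatives
  `N/((X − x₀)·V)` with `N(x₀) V(x₀) ≠ 0`
  (namespace `Literature.Barriers.KontsevichZagierPeriods.KZ.NoSemialgPrimKernel`).

## Audit 2026-08-15 (barrier-audit, D-0021): NARROWED

* *Scope.* The blocked strategy starts from `∫ f = 0`; the vendored integrand `1/(t − 2)` has
  `∫₀¹ ≠ 0`, so `noSemialgebraicPrimitive_inv_sub_two` does not literally instantiate the inductive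
  step. The honest instance at `n = 1` must also quantify the additive constant of the Stokes
  element (`g' = f + (g(1) − g(0))`); this is `algebraicPrimitivesObstructionNarrow`, proved.
* *Technique class.* What the printed argument covers is elimination of a variable by a primitive
  OF THE INTEGRAND taken INSIDE the admissible class (and, by the same token, Moser's inductively
  integrated volume-preserving maps [CressonViusos2022, p. 333]). It does not cover, and live
  routes use: unfolding the primitive as one more variable [KontsevichZagier2001, §1.1]
  [Ayoub2015, Rem. 1.5]; differential elimination, whose certificates are algebraic — Hermite–Trager
  reduction `h = g' + r`, `r = 0` iff an algebraic primitive exists [ChenKauersKoutschan2016,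
  Thm. 13], telescopers with regular rational certificates [BostanLairezSalvy2013, Thm. 12]; the
  choice of the direction of elimination (`(2z₁ − 1)/(z₂ − 2)`); antiderivative-closed enlargements
  of the class, where the holomorphic induction runs verbatim and which contain all periods
  [KaiserIntegratedAlgebraic2024, Thm. B] [CluckersMiller2011, Thm. 1.3]; and, for one-variable
  integrands, completeness in Kontsevich's formal sense by transcendence [HuberWustholz2022,
  Thm. 13.3]. The token `fixed-number-of-variables` is a heuristic about Ayoub's cube calculus,
  where even a one-variable change of variables costs a second variable; it says nothing against
  KZ-rule chains of bounded dimension (rule 2) acts in the same dimension: `f` above is ONE move).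

## Design notes

* `import …KZCalculus` is not needed by any declaration; it is kept so that the cross-references
  to `Literature.NumberTheory.Transcendental.KZ.newtonLeibnizRel` / `Literature.NumberTheory.Transcendental.KZ.IntegralRep` in the docstrings resolve in doc-gen and so
  that the file sits in the calculus' namespace `Literature.KZ` (the catalogue files of this summit extend
  the topic namespaces `Literature.Periods` / `Literature.KZ` rather than `Literature.Barriers`, for dot-notation on the
  calculus' objects).
* The Lean fact quantifies over `ℚ`-**semialgebraic** primitives (the class admitted by rule 3) of
  the H21 calculus), a class strictly larger than the printed algebraic power series; the
  strengthening is true because a semialgebraic function of one real variable satisfies a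
  non-trivial polynomial identity `P(t, F t) = 0` [BasuPollackRoy2006, Prop. 2.86], so on a
  subinterval `log (2 − t) + C` would be algebraic over `ℝ(t)`, contradicting the transcendence of
  `log`. This is declared in `scope_caveats:`. The proof given below obtains the polynomial
  identity directly (step (A)), without [BasuPollackRoy2006, Prop. 2.86].

## References

* [BasuPollackRoy2006] S. Basu, R. Pollack, M.-F. Roy, *Algorithms in Real Algebraic Geometry*,
  Springer 2006, Prop. 2.86 (a semialgebraic function of one variable satisfies `P(x, φ x) = 0`,
  `P ≠ 0`).
* [Ayoub2015] J. Ayoub, *Une version relative de la conjecture des périodes de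
  Kontsevich–Zagier*, Ann. of Math. 181 (2015), Conj. 1.1, Rem. 1.2, Fait 1.4, Rem. 1.5, Thm 1.8,
  Rem. 1.12 (author's preprint used for the wording).
* [Fresan2024] J. Fresán, *Une introduction aux périodes*, X-UPS 2019 (2024), Conj. 3.5, Rem. 3.6,
  Rem. 3.7.
* [CressonViusos2022] J. Cresson, J. Viu-Sos, *On the equality of periods of Kontsevich–Zagier*,
  JTNB 34 (2022), §2.1.
* [Viusos2020] J. Viu-Sos, *A semi-canonical reduction for periods of Kontsevich–Zagier*, IJNT 17
  (2021), Thm 1.1 (algorithmic reduction to volumes inside the KZ rules).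
* [KontsevichZagier2001] §1.1 (p. 3: "introducing more variables … the constant function 1"),
  §1.2, rule 3).
* [HuberWustholz2022] A. Huber, G. Wüstholz, *Transcendence and Linear Relations of 1-Periods*,
  CUP 2022, Thm. 13.3 (p. 121): the Period Conjecture holds for `𝒫¹`.
* [KaiserIntegratedAlgebraic2024] T. Kaiser, *Periods, power series, and integrated algebraic
  numbers*, Math. Ann. 2024 (arXiv:2211.01269), Main Definition (a)–(d), Thm. A, Thm. B.
* [CluckersMiller2011] R. Cluckers, D. J. Miller, Duke Math. J. 156 (2011), Thm. 1.3 (constructible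
  functions are stable under integration).
* [ChenKauersKoutschan2016] S. Chen, M. Kauers, C. Koutschan, ISSAC 2016 (arXiv:1602.00424),
  Thm. 13 (Hermite + polynomial reduction for algebraic functions).
* [BostanLairezSalvy2013] A. Bostan, P. Lairez, B. Salvy, ISSAC 2013 (arXiv:1301.4313), Thm. 12
  (telescoper with regular certificate for every rational function).
-/

noncomputable section

open MeasureTheory Set intervalIntegral

namespace Literature.Barriers.KontsevichZagierPeriods.KZ

/-! ### The holomorphic/continuous mechanism in one variable (proved) -/

/-- **Ayoub's "trivial" mechanism, one real variable.** If `f : ℝ → ℝ` is continuous and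
`∫₀¹ f = 0`, then `f` is a Stokes element: for the primitive `g x = ∫₀ˣ f` one has `g' = f` on
`(0, 1)`, `g` continuous on `[0, 1]`, and `g 1 − g 0 = 0`, i.e. `f = g' − (g|₁ − g|₀)`. In the
algebraic class this step fails because `g` need not be algebraic
(`noSemialgebraicPrimitive_inv_sub_two`). [cite: Ayoub2015, Rem. 1.2] -/
theorem kernel_intervalIntegral_eq_stokes {f : ℝ → ℝ} (hf : Continuous f)
    (h0 : ∫ x in (0 : ℝ)..1, f x = 0) :
    ∃ g : ℝ → ℝ, (∀ x, HasDerivAt g (f x) x) ∧ Continuous g ∧ g 0 = 0 ∧ g 1 - g 0 = 0 := by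
  refine ⟨fun u => ∫ x in (0 : ℝ)..u, f x, fun x => ?_, ?_, by simp, by simp [h0]⟩
  · exact integral_hasDerivAt_right (hf.intervalIntegrable 0 x)
      (hf.stronglyMeasurableAtFilter _ _) hf.continuousAt
  · exact continuous_primitive (fun a b => hf.intervalIntegrable a b) 0

/-! ### The obstruction in the algebraic class (named fact) -/

/-- **No semialgebraic primitive of `1/(t − 2)` on `[0, 1]`.** The real-variable form of
"`1/(z − 2)` has no primitive in `𝒪_{ℚ-alg}(𝔻̄¹)`" [cite: Fresan2024, Rem. 3.6], stated for the
class of primitives admitted by rule 3) of the H21 calculus (`Literature.NumberTheory.Transcendental.KZ.newtonLeibnizRel`: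
`ℚ`-semialgebraic `F` on the band): there is no `ℚ`-semialgebraic `F` on `[0, 1]` whose restriction
to `(0, 1)` has derivative `1/(t − 2)`. Variable elimination by primitives — given `∫ f = 0`,
integrate out one variable with a primitive taken inside the admissible class, as in the
holomorphic proof of [cite: Ayoub2015, Rem. 1.2] (`kernel_intervalIntegral_eq_stokes`) — therefore
leaves the class already for this integrand.

BARRIER (D-0021).
technique_class: primitive-elimination variable-elimination fibrewise-newton-leibniz holomorphic-induction fubini-newton-leibniz-replacement fixed-number-of-variables
blocks: the inductive completeness proof for `Literature.Periods.KZPeriodConjecture` (summit `KontsevichZagierPeriods`; kernel form `Literature.NumberTheory.Transcendental.KZKernelConjecture`) copied from the holomorphic version of Ayoub's Conj. 1.1 (≡ Conjecture 1 [cite: Ayoub2015, Fait 1.4] [cite: Fresan2024, Conj. 3.5]) — "sa version holomorphe est vraie pour une raison plutôt triviale" [cite: Ayoub2015, Rem. 1.2] [cite: Fresan2024, Rem. 3.6]; the strategy "replace Stokes' formula by Fubini's theorem and the Newton–Leibniz formula" [cite: CressonViusos2022, §2.1]; heuristically every form of the conjecture with the number of variables fixed in advance ("a peu de chance d'être vraie")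 [cite: Ayoub2015, Rem. 1.2].
because: "une primitive d'une fonction algébrique est en général une fonction transcendante" [cite: Ayoub2015, Rem. 1.2] — "c'est déjà le cas pour la fonction 1/(z − 2)" [cite: Fresan2024, Rem. 3.6]: its primitives `log (2 − t) + C` are not algebraic over `ℚ(t)`, so the Stokes generator `∂g/∂zₙ − g|₁ + g|₀` with `g = ∫ f dzₙ` leaves the algebraic class ("the integral representations obtained by Fubini's theorem are out of the algebraic class" [cite: CressonViusos2022, §2.1]); the same holds in the larger semialgebraic class of rule 3) because a semialgebraic function of one variable satisfies a non-trivial polynomial identity `P(t, F t) = 0` [cite: BasuPollackRoy2006, Prop. 2.86].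
evasions_known: add variables — the one-variable change of variables is a combination of Stokes elements in two variables [cite: Ayoub2015, Rem. 1.5] [cite: Fresan2024, Rem. 3.7]; pass to the relative setting — with coefficients Laurent series in a formal variable and `k = ℂ` the analogue is a theorem [cite: Ayoub2015, Thm. 1.8], proved motivically ("existe-t-il une preuve élémentaire ?" [cite: Ayoub2015, Rem. 1.12]); inside the KZ rules, reduce algorithmically to volumes of compact semialgebraic sets instead of integrating out variables [cite: Viusos2020, Thm. 1.1].
scope_caveats: an example defeating one proof strategy, not a no-go theorem for Conjecture 1 (the identity `∫₀¹ dt/(2−t) = ∫₁² dt/t` is one change of variables); the fixed-number-of-variables statement is printed as a heuristic only [cite: Ayoub2015, Rem. 1.2]; the Lean class (`ℚ`-semialgebraic primitives on `[0,1]`, derivative on `(0,1)`) is strictly LARGER than the printed one (algebraic power series on the closed disc), so the fact is a true strengthening of the printed example — justified by [cite: BasuPollackRoy2006, Prop. 2.86] plus transcendence of `log` — not a mere transcription. AUDIT 2026-08-15 (NARROWED): the integrand `1/(t − 2)` is not itself a kernel element (`∫₀¹ dt/(t − 2) = −log 2 ≠ 0`), so this fact does not literally instantiate the blocked step, which starts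 from `∫ f = 0` and produces a Stokes element `g' − (g(1) − g(0))`, i.e. a primitive of `f + c` for SOME constant `c`; the kernel-element form with the constant quantified is `algebraicPrimitivesObstructionNarrow` below (proved), whose block also narrows the tokens `variable-elimination` (only IN-CLASS primitive elimination is covered — unfolding, differential elimination with algebraic certificates, direction choice and antiderivative-closed enlargements are not) and `fixed-number-of-variables` (level `n = 1` of Ayoub's cube calculus settled; nothing against KZ-rule chains of bounded dimension).
status: established (the example is a theorem — transcendence of `log` over `ℝ(t)` and [cite: BasuPollackRoy2006, Prop. 2.86]); vendored as a named fact and PROVED in this file (`noSemialgebraicPrimitive_inv_sub_two_holds`, standard axioms). -/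
def noSemialgebraicPrimitive_inv_sub_two : Prop :=
  ¬ ∃ F : (Fin 1 → ℝ) → ℝ, Literature.NumberTheory.Transcendental.IsSemialgebraicFunOn ℚ {x | x 0 ∈ Icc (0 : ℝ) 1} F ∧
      ∀ t ∈ Ioo (0 : ℝ) 1, HasDerivAt (fun s : ℝ => F (fun _ => s)) (1 / (t - 2)) t

/-- What a semialgebraic primitive would buy: if `F` were a `ℚ`-semialgebraic primitive of
`1/(t − 2)` on `[0, 1]`, continuous on `[0, 1]`, then `∫₀¹ dt/(t − 2) = F 1 − F 0` by the
fundamental theorem of calculus — the fibrewise content of one Newton–Leibniz move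
(`KZ.newtonLeibnizRel` with `n = 0`, `a = 0`, `b = 1`). Proved (FTC), to make explicit which step
of the strategy the barrier removes: not the evaluation, but the membership of `F` in the class.
[cite: KontsevichZagier2001, §1.2  rule 3)] -/
theorem integral_inv_sub_two_eq_of_primitive {F : (Fin 1 → ℝ) → ℝ}
    (hcont : ContinuousOn (fun s : ℝ => F (fun _ => s)) (Icc 0 1))
    (hderiv : ∀ t ∈ Ioo (0 : ℝ) 1, HasDerivAt (fun s : ℝ => F (fun _ => s)) (1 / (t - 2)) t) :
    ∫ t in (0 : ℝ)..1, 1 / (t - 2) = F (fun _ => 1) - F (fun _ => 0) := by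
  have hint : IntervalIntegrable (fun t : ℝ => 1 / (t - 2)) volume 0 1 := by
    apply ContinuousOn.intervalIntegrable
    apply ContinuousOn.div continuousOn_const (continuousOn_id.sub continuousOn_const)
    intro x hx
    rw [uIcc_of_le zero_le_one] at hx
    have hx1 : x ≤ 1 := hx.2
    have hne : x - 2 ≠ 0 := by
      intro h
      linarith
    simpa using hne
  exact integral_eq_sub_of_hasDerivAt_of_le zero_le_one hcont (fun t ht => hderiv t ht) hint


/-! ### Discharge of the named fact (proved)

`noSemialgebraicPrimitive_inv_sub_two_holds` below proves the BARRIER fact. Architecture (steps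
(A)–(D) of the module docstring); all auxiliaries live in the namespace `Literature.KZ.NoSemialgPrim`.
The argument never uses the closed form `log (2 − t) + C` of the primitive: only
`G' = 1/(t − 2)` on `(0, 1)` enters, through the derivative of `t ↦ P(t, G t)`. -/

namespace NoSemialgPrim

open Polynomial
open scoped Polynomial.Bivariate

/-- Bridge between `MvPolynomial (Fin 2) ℝ` and `ℝ[X][Y]`: evaluation is compatible with
`Polynomial.Bivariate.equivMvPolynomial`. [folklore] -/
theorem evalEval_equivMvPolynomial_symm (q : MvPolynomial (Fin 2) ℝ) (z : Fin 2 → ℝ) :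
    ((Bivariate.equivMvPolynomial ℝ).symm q).evalEval (z 0) (z 1) = MvPolynomial.eval z q := by
  induction q using MvPolynomial.induction_on with
  | C a => simp
  | add p q hp hq => simp [hp, hq]
  | mul_X p i hp =>
    fin_cases i <;> simp [hp, Polynomial.evalEval_C, Polynomial.eval_X]

/-- The set where a real polynomial in two variables does not vanish is open. [folklore] -/
theorem isOpen_eval_ne_zero (q : MvPolynomial (Fin 2) ℝ) :
    IsOpen {z : Fin 2 → ℝ | MvPolynomial.eval z q ≠ 0} :=
  (MvPolynomial.continuous_eval q).isOpen_preimage _ isOpen_compl_singleton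

/-- Real evaluation of a rational polynomial: `eval z (map (ℚ → ℝ) p) = aeval z p`. [folklore] -/
theorem eval_map_algebraMap (p : MvPolynomial (Fin 2) ℚ) (z : Fin 2 → ℝ) :
    MvPolynomial.eval z (MvPolynomial.map (algebraMap ℚ ℝ) p) = MvPolynomial.aeval z p := by
  rw [MvPolynomial.eval_map, MvPolynomial.aeval_def]

/-- **Step (A).** Every `ℚ`-semialgebraic subset of `ℝ²` is, off the zero set of some non-zero
real polynomial, both open and closed. Proved by induction over the Boolean algebra generated by
the sets `{p = 0}` and `{p > 0}`; no Tarski–Seidenberg is needed. [folklore] -/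
theorem exists_ne_zero_isOpen {S : Set (Fin 2 → ℝ)} (hS : Literature.ModelTheory.ExponentialFields.IsSemialgebraic ℚ S) :
    ∃ q : MvPolynomial (Fin 2) ℝ, q ≠ 0 ∧ IsOpen (S ∩ {z | MvPolynomial.eval z q ≠ 0}) ∧
      IsOpen (Sᶜ ∩ {z | MvPolynomial.eval z q ≠ 0}) := by
  unfold Literature.ModelTheory.ExponentialFields.IsSemialgebraic Literature.ModelTheory.ExponentialFields.semialgebraicSets at hS
  induction hS using BooleanSubalgebra.closure_bot_sup_induction with
  | mem S hS =>
    rcases hS with ⟨p, rfl⟩ | ⟨p, rfl⟩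
    · by_cases hp : MvPolynomial.map (algebraMap ℚ ℝ) p = 0
      · have hall : ∀ z : Fin 2 → ℝ, MvPolynomial.aeval z p = 0 := fun z => by
          rw [← eval_map_algebraMap, hp, map_zero]
        refine ⟨1, one_ne_zero, ?_, ?_⟩
        · convert isOpen_univ
          ext z
          simp [hall z]
        · convert isOpen_empty
          ext z
          simp [hall z]
      · refine ⟨_, hp, ?_, ?_⟩
        · convert isOpen_empty
          ext z
          simp only [mem_inter_iff, mem_setOf_eq, eval_map_algebraMap, mem_empty_iff_false,
            iff_false, not_and, not_not]
          exact fun h => h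
        · convert isOpen_eval_ne_zero (MvPolynomial.map (algebraMap ℚ ℝ) p) using 1
          ext z
          simp only [mem_inter_iff, mem_compl_iff, mem_setOf_eq, eval_map_algebraMap]
          tauto
    · by_cases hp : MvPolynomial.map (algebraMap ℚ ℝ) p = 0
      · have hall : ∀ z : Fin 2 → ℝ, MvPolynomial.aeval z p = 0 := fun z => by
          rw [← eval_map_algebraMap, hp, map_zero]
        refine ⟨1, one_ne_zero, ?_, ?_⟩
        · convert isOpen_empty
          ext z
          simp [hall z]
        · convert isOpen_univ
          ext z
          simp [hall z]
      · refine ⟨_, hp, ?_, ?_⟩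
        · have hopen : IsOpen {z : Fin 2 → ℝ | 0 < MvPolynomial.eval z
              (MvPolynomial.map (algebraMap ℚ ℝ) p)} :=
            isOpen_lt continuous_const (MvPolynomial.continuous_eval _)
          convert hopen using 1
          ext z
          simp only [mem_inter_iff, mem_setOf_eq, eval_map_algebraMap]
          exact ⟨fun h => h.1, fun h => ⟨h, h.ne'⟩⟩
        · have hopen : IsOpen {z : Fin 2 → ℝ | MvPolynomial.eval z
              (MvPolynomial.map (algebraMap ℚ ℝ) p) < 0} :=
            isOpen_lt (MvPolynomial.continuous_eval _) continuous_const
          convert hopen using 1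
          ext z
          simp only [mem_inter_iff, mem_compl_iff, mem_setOf_eq, eval_map_algebraMap, not_lt]
          exact ⟨fun h => lt_of_le_of_ne h.1 h.2, fun h => ⟨h.le, h.ne⟩⟩
  | bot =>
    exact ⟨1, one_ne_zero, by simp, by simp⟩
  | sup S hS T hT ihS ihT =>
    obtain ⟨p, hp, hp1, hp2⟩ := ihS
    obtain ⟨q, hq, hq1, hq2⟩ := ihT
    refine ⟨p * q, mul_ne_zero hp hq, ?_, ?_⟩
    · have : ((S ⊔ T) ∩ {z : Fin 2 → ℝ | MvPolynomial.eval z (p * q) ≠ 0}) =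
          (S ∩ {z | MvPolynomial.eval z p ≠ 0}) ∩ {z | MvPolynomial.eval z q ≠ 0} ∪
            (T ∩ {z | MvPolynomial.eval z q ≠ 0}) ∩ {z | MvPolynomial.eval z p ≠ 0} := by
        ext z
        simp only [sup_eq_union, mem_inter_iff, mem_union, mem_setOf_eq, map_mul, mul_ne_zero_iff]
        tauto
      rw [this]
      exact (hp1.inter (isOpen_eval_ne_zero q)).union (hq1.inter (isOpen_eval_ne_zero p))
    · have : ((S ⊔ T)ᶜ ∩ {z : Fin 2 → ℝ | MvPolynomial.eval z (p * q) ≠ 0}) =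
          (Sᶜ ∩ {z | MvPolynomial.eval z p ≠ 0}) ∩ (Tᶜ ∩ {z | MvPolynomial.eval z q ≠ 0}) := by
        ext z
        simp only [sup_eq_union, compl_union, mem_inter_iff, mem_compl_iff, mem_setOf_eq, map_mul,
          mul_ne_zero_iff]
        tauto
      rw [this]
      exact hp2.inter hq2
  | compl S hS ih =>
    obtain ⟨p, hp, h1, h2⟩ := ih
    exact ⟨p, hp, h2, by simpa only [compl_compl] using h1⟩


/-- Logarithmic-derivative bookkeeping: `u · (uᵐ a)' = uᵐ (m a + u a')` when `u' = 1`. [folklore] -/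
theorem mul_derivative_pow_mul (u a : ℝ[X]) (hu : derivative u = 1) (m : ℕ) :
    u * derivative (u ^ m * a) = u ^ m * (C (m : ℝ) * a + u * derivative a) := by
  cases m with
  | zero => simp
  | succ k =>
    rw [derivative_mul, derivative_pow_succ, hu]
    push_cast
    ring

/-- **Step (D), core.** The `(X − 2)`-adic valuation argument: with `a(2) b(2) ≠ 0`, `d ≠ 0`,
`u = X − 2`, the polynomial `u^{m+r} ((r − m) a b + u (a b' − a' b)) + d u^{2m} a²` is non-zero
(compare orders of vanishing at `2` in the three cases `r < m`, `r = m`, `r > m`). [folklore] -/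
theorem core_ne_zero (u a b : ℝ[X]) (hu0 : u ≠ 0) (hu2 : u.eval 2 = 0) (m r d : ℕ)
    (ha : a.eval 2 ≠ 0) (hb : b.eval 2 ≠ 0) (hd : (d : ℝ) ≠ 0) :
    u ^ (m + r) * ((C (r : ℝ) - C (m : ℝ)) * a * b + u * (a * derivative b - derivative a * b))
      + C (d : ℝ) * u ^ (2 * m) * a ^ 2 ≠ 0 := by
  intro H
  rcases lt_trichotomy r m with h | rfl | h
  · obtain ⟨e, rfl⟩ := Nat.exists_eq_add_of_lt h
    have hV : u ^ (r + e + 1 + r) *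
        ((C (r : ℝ) - C ((r + e + 1 : ℕ) : ℝ)) * a * b + u * (a * derivative b - derivative a * b)
          + C (d : ℝ) * u ^ (e + 1) * a ^ 2) = 0 := by
      linear_combination H
    have hV' := (mul_eq_zero.mp hV).resolve_left (pow_ne_zero _ hu0)
    have h2 := congrArg (Polynomial.eval 2) hV'
    simp only [eval_add, eval_mul, eval_sub, eval_C, eval_pow, hu2, zero_mul, add_zero,
      zero_pow (Nat.succ_ne_zero e), mul_zero, eval_zero] at h2
    have hcoef : ((r : ℝ) - ((r + e + 1 : ℕ) : ℝ)) ≠ 0 := by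
      push_cast
      linarith
    exact mul_ne_zero (mul_ne_zero hcoef ha) hb h2
  · have hV : u ^ (2 * r) * (u * (a * derivative b - derivative a * b) + C (d : ℝ) * a ^ 2) = 0 := by
      linear_combination H
    have hV' := (mul_eq_zero.mp hV).resolve_left (pow_ne_zero _ hu0)
    have h2 := congrArg (Polynomial.eval 2) hV'
    simp only [eval_add, eval_mul, eval_sub, eval_C, eval_pow, hu2, zero_mul, zero_add,
      eval_zero] at h2
    exact mul_ne_zero hd (pow_ne_zero 2 ha) h2
  · obtain ⟨e, rfl⟩ := Nat.exists_eq_add_of_lt h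
    have hV : u ^ (2 * m) * (u ^ (e + 1) *
        ((C ((m + e + 1 : ℕ) : ℝ) - C (m : ℝ)) * a * b + u * (a * derivative b - derivative a * b))
          + C (d : ℝ) * a ^ 2) = 0 := by
      linear_combination H
    have hV' := (mul_eq_zero.mp hV).resolve_left (pow_ne_zero _ hu0)
    have h2 := congrArg (Polynomial.eval 2) hV'
    simp only [eval_add, eval_mul, eval_sub, eval_C, eval_pow, hu2, zero_mul, zero_add,
      zero_pow (Nat.succ_ne_zero e), eval_zero] at h2
    exact mul_ne_zero hd (pow_ne_zero 2 ha) h2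

/-- **Step (D).** The coefficient identity forced by a minimal algebraic relation is impossible:
for `p ≠ 0` and `d ≠ 0`, `p ((X − 2) q' + d p) ≠ (X − 2) p' q` (no rational function has
derivative `d/(X − 2)`: derivatives of rational functions have no simple poles). [folklore] -/
theorem coeff_identity_ne_zero (p q : ℝ[X]) (d : ℕ) (hd : d ≠ 0) (hp : p ≠ 0) :
    p * ((X - C 2) * derivative q + C (d : ℝ) * p) - (X - C 2) * derivative p * q ≠ 0 := by
  intro E
  have hdR : (d : ℝ) ≠ 0 := Nat.cast_ne_zero.mpr hd
  by_cases hq : q = 0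
  · subst hq
    simp only [derivative_zero, mul_zero, zero_add, sub_zero] at E
    rcases mul_eq_zero.mp E with h | h
    · exact hp h
    · rcases mul_eq_zero.mp h with h' | h'
      · exact hdR (C_eq_zero.mp h')
      · exact hp h'
  obtain ⟨a, hpa, hna⟩ := p.exists_eq_pow_rootMultiplicity_mul_and_not_dvd hp 2
  obtain ⟨b, hqb, hnb⟩ := q.exists_eq_pow_rootMultiplicity_mul_and_not_dvd hq 2
  have ha : a.eval 2 ≠ 0 := fun h => hna (dvd_iff_isRoot.mpr h)
  have hb : b.eval 2 ≠ 0 := fun h => hnb (dvd_iff_isRoot.mpr h)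
  set m := p.rootMultiplicity 2 with hm
  set r := q.rootMultiplicity 2 with hr
  set u : ℝ[X] := X - C 2 with hu
  have hu0 : u ≠ 0 := X_sub_C_ne_zero 2
  have hu1 : derivative u = 1 := derivative_X_sub_C 2
  have hu2 : u.eval 2 = 0 := by simp [hu]
  have hp' : u * derivative p = u ^ m * (C (m : ℝ) * a + u * derivative a) := by
    rw [hpa]; exact mul_derivative_pow_mul u a hu1 m
  have hq' : u * derivative q = u ^ r * (C (r : ℝ) * b + u * derivative b) := by
    rw [hqb]; exact mul_derivative_pow_mul u b hu1 r
  have E2 : p * (u * derivative q) + C (d : ℝ) * p ^ 2 - (u * derivative p) * q = 0 := by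
    linear_combination E
  rw [hp', hq'] at E2
  rw [hpa, hqb] at E2
  exact core_ne_zero u a b hu0 hu2 m r d ha hb hdR (by linear_combination E2)



/-- Coefficients of an explicit finite sum `∑_{j<N} C (f j) Y^j`. [folklore] -/
theorem coeff_sum_C_mul_X_pow {R : Type*} [Semiring R] (f : ℕ → R) (N k : ℕ) :
    (∑ j ∈ Finset.range N, C (f j) * X ^ j).coeff k = if k < N then f k else 0 := by
  simp

/-- **Step (C), analytic input.** If `G' = 1/(t − 2)` on `(0, 1)` and
`∑ⱼ pⱼ(s) G(s)ʲ = 0` on `(0, 1)`, then differentiating and multiplying by `t − 2` gives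
`∑ⱼ ((t − 2) pⱼ'(t) G(t)ʲ + j pⱼ(t) G(t)ʲ⁻¹) = 0`. [folklore] -/
theorem sum_deriv_eq_zero {G : ℝ → ℝ} (hG : ∀ t ∈ Ioo (0:ℝ) 1, HasDerivAt G (1 / (t - 2)) t)
    (N : ℕ) (p : ℕ → ℝ[X])
    (hv : ∀ s ∈ Ioo (0:ℝ) 1, ∑ j ∈ Finset.range N, (p j).eval s * G s ^ j = 0)
    {t : ℝ} (ht : t ∈ Ioo (0:ℝ) 1) :
    ∑ j ∈ Finset.range N,
      ((t - 2) * (derivative (p j)).eval t * G t ^ j + (j : ℝ) * (p j).eval t * G t ^ (j - 1)) = 0 := by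
  have hf : HasDerivAt (fun s => ∑ j ∈ Finset.range N, (p j).eval s * G s ^ j)
      (∑ j ∈ Finset.range N, ((derivative (p j)).eval t * G t ^ j +
        (p j).eval t * ((j : ℝ) * G t ^ (j - 1) * (1 / (t - 2))))) t :=
    HasDerivAt.fun_sum fun j _ => ((p j).hasDerivAt t).mul ((hG t ht).pow j)
  have h0 : HasDerivAt (fun s => ∑ j ∈ Finset.range N, (p j).eval s * G s ^ j) 0 t := by
    apply (hasDerivAt_const t (0:ℝ)).congr_of_eventuallyEq
    filter_upwards [Ioo_mem_nhds ht.1 ht.2] with s hs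
    exact hv s hs
  have hsum := hf.unique h0
  have ht2 : t - 2 ≠ 0 := by
    have := ht.2
    intro h
    linarith
  calc ∑ j ∈ Finset.range N,
        ((t - 2) * (derivative (p j)).eval t * G t ^ j + (j : ℝ) * (p j).eval t * G t ^ (j - 1))
      = (t - 2) * ∑ j ∈ Finset.range N, ((derivative (p j)).eval t * G t ^ j +
          (p j).eval t * ((j : ℝ) * G t ^ (j - 1) * (1 / (t - 2)))) := by
        rw [Finset.mul_sum]
        refine Finset.sum_congr rfl fun j _ => ?_
        field_simp
    _ = 0 := by rw [hsum, mul_zero]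

/-- **Step (C).** A function with derivative `1/(t − 2)` on `(0, 1)` satisfies no non-trivial
polynomial relation `P(t, G t) = 0` on `(0, 1)` (transcendence of `log (2 − t) + C` over `ℝ(t)`,
proved by descent on the degree in the second variable). [folklore] -/
theorem eq_zero_of_evalEval_eq_zero {G : ℝ → ℝ}
    (hG : ∀ t ∈ Ioo (0:ℝ) 1, HasDerivAt G (1 / (t - 2)) t) :
    ∀ (n : ℕ) (P : ℝ[X][Y]), P.natDegree ≤ n →
      (∀ t ∈ Ioo (0:ℝ) 1, P.evalEval t (G t) = 0) → P = 0 := by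
  intro n
  induction n with
  | zero =>
    intro P hP hv
    have hPC : P = C (P.coeff 0) := eq_C_of_natDegree_le_zero hP
    have h0 : P.coeff 0 = 0 := by
      apply Polynomial.eq_zero_of_infinite_isRoot
      refine Set.Infinite.mono ?_ (Set.Ioo_infinite (zero_lt_one' ℝ))
      intro t ht
      have := hv t ht
      rw [hPC, evalEval_C] at this
      exact this
    rw [hPC, h0, map_zero]
  | succ n ih =>
    intro P hP hv
    by_cases hd : P.natDegree ≤ n
    · exact ih P hd hv
    have hdeg : P.natDegree = n + 1 := by omega
    by_contra hP0
    have hlead : P.coeff (n + 1) ≠ 0 := by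
      rw [← hdeg]
      exact leadingCoeff_ne_zero.mpr hP0
    -- notation
    set p : ℕ → ℝ[X] := fun j => P.coeff j with hp_def
    set u : ℝ[X] := X - C 2 with hu_def
    set Q₁ : ℝ[X][Y] := ∑ j ∈ Finset.range (n + 2), C (u * derivative (p j)) * Y ^ j with hQ₁
    set Q₂ : ℝ[X][Y] := ∑ j ∈ Finset.range (n + 1), C (C ((j : ℝ) + 1) * p (j + 1)) * Y ^ j
      with hQ₂
    set R : ℝ[X][Y] := C (p (n + 1)) * (Q₁ + Q₂) - C (u * derivative (p (n + 1))) * P with hR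
    -- P as an explicit sum, and its values on the curve
    have hPsum : P = ∑ j ∈ Finset.range (n + 2), C (p j) * Y ^ j := by
      have := P.as_sum_range_C_mul_X_pow
      rw [hdeg] at this
      exact this
    have hfP : ∀ s, P.evalEval s (G s) = ∑ j ∈ Finset.range (n + 2), (p j).eval s * G s ^ j := by
      intro s
      conv_lhs => rw [hPsum]
      simp [evalEval_finsetSum, evalEval_C]
    have hv' : ∀ s ∈ Ioo (0:ℝ) 1, ∑ j ∈ Finset.range (n + 2), (p j).eval s * G s ^ j = 0 :=
      fun s hs => (hfP s) ▸ hv s hs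
    -- the derivative polynomial vanishes on the curve
    have hQ : ∀ t ∈ Ioo (0:ℝ) 1, (Q₁ + Q₂).evalEval t (G t) = 0 := by
      intro t ht
      have key := sum_deriv_eq_zero hG (n + 2) p hv' ht
      rw [Finset.sum_add_distrib,
        Finset.sum_range_succ' (fun j => (j : ℝ) * (p j).eval t * G t ^ (j - 1))] at key
      simp only [Nat.cast_zero, zero_mul, add_zero, Nat.add_sub_cancel, Nat.cast_succ] at key
      have e1 : Q₁.evalEval t (G t) =
          ∑ j ∈ Finset.range (n + 2), (t - 2) * (derivative (p j)).eval t * G t ^ j := by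
        simp only [hQ₁, evalEval_finsetSum, evalEval_mul, evalEval_C, evalEval_pow, evalEval_X,
          eval_mul, eval_sub, eval_X, eval_C, hu_def]
      have e2 : Q₂.evalEval t (G t) =
          ∑ j ∈ Finset.range (n + 1), ((j : ℝ) + 1) * (p (j + 1)).eval t * G t ^ j := by
        simp only [hQ₂, evalEval_finsetSum, evalEval_mul, evalEval_C, evalEval_pow, evalEval_X,
          eval_mul, eval_C]
      rw [evalEval_add, e1, e2]
      exact key
    have hvR : ∀ t ∈ Ioo (0:ℝ) 1, R.evalEval t (G t) = 0 := by
      intro t ht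
      simp only [hR, evalEval_sub, evalEval_mul, evalEval_C, hQ t ht, hv t ht, mul_zero, sub_zero]
    -- R has smaller degree
    have hcQ₁ : ∀ k, Q₁.coeff k = if k < n + 2 then u * derivative (p k) else 0 := fun k => by
      rw [hQ₁]; exact coeff_sum_C_mul_X_pow (fun j => u * derivative (p j)) (n + 2) k
    have hcQ₂ : ∀ k, Q₂.coeff k = if k < n + 1 then C ((k : ℝ) + 1) * p (k + 1) else 0 :=
      fun k => by
      rw [hQ₂]; exact coeff_sum_C_mul_X_pow (fun j => C ((j : ℝ) + 1) * p (j + 1)) (n + 1) k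
    have hcR : ∀ k, R.coeff k = p (n + 1) * (Q₁.coeff k + Q₂.coeff k) -
        u * derivative (p (n + 1)) * P.coeff k := fun k => by
      simp only [hR, coeff_sub, coeff_C_mul, coeff_add]
    have hRdeg : R.natDegree ≤ n := by
      rw [Polynomial.natDegree_le_iff_coeff_eq_zero]
      intro N hN
      rw [hcR, hcQ₁, hcQ₂]
      rcases Nat.lt_or_ge N (n + 2) with h | h
      · have hN1 : N = n + 1 := by omega
        subst hN1
        simp only [show n + 1 < n + 2 by omega, if_true, lt_irrefl, if_false, add_zero]
        simp only [hp_def]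
        ring
      · have hPN : P.coeff N = 0 := coeff_eq_zero_of_natDegree_lt (by omega)
        simp only [show ¬ (N < n + 2) by omega, show ¬ (N < n + 1) by omega, if_false, add_zero,
          mul_zero, hPN, sub_zero]
    have hR0 : R = 0 := ih R hRdeg hvR
    -- the coefficient of `Y ^ n` of `R` is the forbidden identity
    have hcoef := hcR n
    rw [hR0, coeff_zero, hcQ₁, hcQ₂] at hcoef
    simp only [show n < n + 2 by omega, show n < n + 1 by omega, if_true] at hcoef
    apply coeff_identity_ne_zero (p (n + 1)) (p n) (n + 1) (Nat.succ_ne_zero n) hlead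
    rw [hu_def] at hcoef
    have : (((n + 1 : ℕ) : ℝ)) = (n : ℝ) + 1 := by push_cast; ring
    rw [this]
    linear_combination -hcoef

end NoSemialgPrim

open Polynomial in
open scoped Polynomial.Bivariate in
/-- **The barrier fact holds**: no `ℚ`-semialgebraic function on `[0, 1]` has derivative
`1/(t − 2)` on `(0, 1)` — the real-variable form of "`1/(z − 2)` has no algebraic primitive"
[cite: Fresan2024, Rem. 3.6] [cite: Ayoub2015, Rem. 1.2], here a theorem (steps (A)–(D) of the
module docstring; the semialgebraic-to-algebraic step replaces [cite: BasuPollackRoy2006, Prop. 2.86]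
by a direct induction over the Boolean algebra of `ℚ`-semialgebraic sets). -/
theorem noSemialgebraicPrimitive_inv_sub_two_holds : noSemialgebraicPrimitive_inv_sub_two := by
  rintro ⟨F, hF, hderiv⟩
  -- the graph of `F` over `[0,1]`, as a subset of `ℝ²`
  set Γ : Set (Fin 2 → ℝ) :=
    {z | ∃ x ∈ {x : Fin 1 → ℝ | x 0 ∈ Icc (0 : ℝ) 1}, z = Fin.snoc x (F x)} with hΓ
  have hΓ' : Literature.ModelTheory.ExponentialFields.IsSemialgebraic ℚ Γ := hF
  -- (A) a non-zero real polynomial off whose zero set `Γ` is open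
  obtain ⟨q, hq0, hopen, -⟩ := NoSemialgPrim.exists_ne_zero_isOpen hΓ'
  -- (B) a graph has empty interior, so `Γ ⊆ {q = 0}`
  have hvan : ∀ z ∈ Γ, MvPolynomial.eval z q = 0 := by
    intro z hz
    by_contra hne
    obtain ⟨ε, hε, hball⟩ := Metric.isOpen_iff.mp hopen z ⟨hz, hne⟩
    obtain ⟨x, hx, rfl⟩ := hz
    have hmem : (Fin.snoc x (F x + ε / 2) : Fin 2 → ℝ) ∈
        Metric.ball (Fin.snoc x (F x) : Fin 2 → ℝ) ε := by
      rw [Metric.mem_ball, dist_pi_lt_iff hε]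
      intro i
      fin_cases i
      · simp [Fin.snoc, hε]
      · simp [Fin.snoc, abs_of_pos hε, half_lt_self hε]
    obtain ⟨⟨x', -, hxx'⟩, -⟩ := hball hmem
    have h0 : x = x' := by
      funext j
      fin_cases j
      simpa [Fin.snoc] using congrFun hxx' 0
    have h1 := congrFun hxx' 1
    simp only [Fin.snoc] at h1
    simp [← h0] at h1
    exact absurd h1 hε.ne'
  -- transfer to `ℝ[X][Y]`
  set P : ℝ[X][Y] := (Polynomial.Bivariate.equivMvPolynomial ℝ).symm q with hP
  have hP0 : P ≠ 0 := by simpa [hP] using hq0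
  have hPv : ∀ t ∈ Ioo (0 : ℝ) 1, P.evalEval t (F fun _ => t) = 0 := by
    intro t ht
    have hz : (Fin.snoc (fun _ : Fin 1 => t) (F fun _ => t) : Fin 2 → ℝ) ∈ Γ :=
      ⟨fun _ => t, Ioo_subset_Icc_self ht, rfl⟩
    have h := hvan _ hz
    rw [← NoSemialgPrim.evalEval_equivMvPolynomial_symm] at h
    simpa [Fin.snoc] using h
  -- (C)+(D)
  exact hP0 (NoSemialgPrim.eq_zero_of_evalEval_eq_zero hderiv P.natDegree P le_rfl hPv)

/-! ### NARROW form (barrier audit 2026-08-15): a kernel element with no one-variable Stokes certificate -/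

/-- **Kernel-element form of the obstruction: one-variable Stokes certificates do not reach
`2t/(2 − t²) − 1/(2 − t)`** (NARROW replacement of `noSemialgebraicPrimitive_inv_sub_two`,
barrier audit 2026-08-15). With Fresán's `φ(z) = 1/(2 − z) ∈ 𝒪_{ℚ-alg}(𝔻̄¹)` and the change of
variables `u(z) = z²` (`u(0) = 0`, `u(1) = 1`), the element `f = u'·(φ ∘ u) − φ`, i.e.
`f(t) = 2t/(2 − t²) − 1/(2 − t)` (rational over `ℚ`, poles `2, ±√2` outside the closed unit disc,
so `f ∈ 𝒪_{ℚ-alg}(𝔻̄¹)`), lies in the kernel: `∫₀¹ f = 0` (`integral_kernelElt_eq_zero`) — it is the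
change-of-variables relation `∫₀¹ φ = ∫₀¹ u'·φ(u)`, ONE move of rule 2) in dimension 1, and a
combination of Stokes elements of algebraic `g`'s in TWO variables, printed for exactly this shape
[cite: Ayoub2015, Rem. 1.5] [cite: Fresan2024, Rem. 3.7]. The fact: for no real constant `c` does
`f + c` admit a `ℚ`-semialgebraic primitive on `[0, 1]` (derivative on `(0, 1)`). Equivalently
(`kernelElt_not_stokes_one_variable`) `f` is not a one-variable Stokes element
`g' − (g(1) − g(0))` of any `ℚ`-semialgebraic `g`: the inductive step of the holomorphic proof
[cite: Ayoub2015, Rem. 1.2] [cite: Fresan2024, Rem. 3.6] fails ON A KERNEL ELEMENT at `n = 1`, and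
level `n = 1` of "il est probablement nécessaire d'utiliser des fonctions `g` qui dépendent de plus
de `n + 1` variables" [cite: Ayoub2015, Rem. 1.2] is settled: one variable does not suffice for
this `f`, two do.

BARRIER (D-0021).
technique_class: in-class-primitive-elimination holomorphic-induction fubini-newton-leibniz-replacement moser-inductive-integration same-arity-stokes-certificates
blocks: (i) the inductive completeness proof for `Literature.Periods.KZPeriodConjecture` (kernel form `Literature.NumberTheory.Transcendental.KZKernelConjecture`) copied from the holomorphic version of Conj. 1.1 [cite: Ayoub2015, Rem. 1.2] [cite: Fresan2024, Rem. 3.6] — already its step `n = 1 → 0`, on the kernel element `f`; (ii) "replace Stokes' formula by Fubini's theorem and the Newton–Leibniz formula" with primitives in the class [cite: CressonViusos2022, §2.1]; (iii) Moser's volume-preserving change of variables as a route to Conjecture 1 — "transcendental in most of the cases, since the construction is made by using integration inductively over each variable" [cite: CressonViusos2022, §2.3]; (iv) any presentation of the kernel in `n` variables by Stokes elements of `g`'s in the SAME `n` variables (Ayoub's cube calculus with no extra variable), refuted here at `n = 1`.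
because: a one-variable Stokes certificate `g` for `f` has `g' = f + (g(1) − g(0))` on `(0, 1)`, and `f + c` keeps the simple pole `t = 2` with residue `1` for every constant `c`; a `ℚ`-semialgebraic `g` on `[0, 1]` satisfies `P(t, g t) = 0` with `P ≠ 0` in `ℝ[X][Y]` (steps (A)–(B): `NoSemialgPrimKernel.exists_ne_zero_evalEval_eq_zero`), and descent on `deg_Y P` forces the coefficient identity `(X − 2)(X² − 2)(p_d p_{d−1}' − p_d' p_{d−1}) + d·N·p_d² = 0` with `N = −2X(X − 2) + (X² − 2) + c (X − 2)(X² − 2)`, `N(2) = 2 ≠ 0`, impossible by `(X − 2)`-adic valuation (`NoSemialgPrimKernel.coeff_identity_ne_zero`: the polynomial shadow of "no function algebraic over `ℝ(t)` has a derivative with a non-zero residue").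
evasions_known: OUTSIDE the class and not obstructed — (a) add variables / unfold the primitive (`∫₀ˣ h = ∫₀¹ x·h(xu) du` is algebraic data in one more variable): the one-variable change of variables is two Stokes elements in two variables [cite: Ayoub2015, Rem. 1.5] [cite: Fresan2024, Rem. 3.7], "algebraic functions occurring in the integrand can be replaced by rational functions by introducing more variables … we never need to integrate any function more complicated than the constant function 1" [cite: KontsevichZagier2001, §1.1], and inside the KZ rules `f` is ONE change of variables in dimension 1; (b) differential elimination with algebraic certificates: Hermite–Trager reduction writes an algebraic `h` as `g' + r` with `g` in the same function field and `r = 0` iff `h` has a primitive there — the obstruction is a finite-dimensional, decidable remainder [cite: ChenKauersKoutschan2016, Thm. 13] — and every rational integrand has a telescoper `L(z', ∂_{z'})` with regular rational certificate [cite: BostanLairezSalvy2013, Thm. 12]; (c) the direction of elimination: `(2z₁ − 1)/(z₂ − 2)` is a kernel element whose `z₂`-primitive is transcendental but which IS the Stokes element `∂_{z₁}[(z₁² − z₁)/(z₂ − 2)]` in the same two variables; (d) antiderivative-closed enlargements: in the rings of integrated-algebraic power series (the closure of the algebraic power series under reciprocals, rational substitutions and translations, and formal antiderivatives), whose coefficient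 field contains every period [cite: KaiserIntegratedAlgebraic2024, Thm. B], and in the constructible class, stable under integration [cite: CluckersMiller2011, Thm. 1.3], the holomorphic induction runs verbatim, and the content of Conjecture 1 becomes conservativity of `𝒪_alg ⊂ 𝒪_IA` on the Stokes quotients; (e) one-variable integrands: all `ℚ̄`-linear relations among 1-periods come from bilinearity and functoriality — completeness in Kontsevich's formal sense is a theorem by transcendence, not by elimination [cite: HuberWustholz2022, Thm. 13.3]; (f) the relative setting [cite: Ayoub2015, Thm. 1.8]; (g) algorithmic reduction to volumes [cite: Viusos2020, Thm. 1.1].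
scope_caveats: settles level `n = 1` only (one variable insufficient, two sufficient for this `f`); whether `n + 1` variables always suffice or some kernel element needs more [cite: Ayoub2015, Rem. 1.2] is open at every level `n ≥ 1`; real-variable `ℚ`-semialgebraic transcription, a certificate class strictly larger than algebraic power series on the closed disc (as for the old block); an obstruction to proof strategies and to same-arity certificates, not a no-go for Conjecture 1 and not an obstruction to KZ-rule chains of bounded dimension.
status: established — PROVED in this file (`algebraicPrimitivesObstructionNarrow_holds`; corollary `kernelElt_not_stokes_one_variable`; `integral_kernelElt_eq_zero`; standard axioms). -/
def algebraicPrimitivesObstructionNarrow : Prop :=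
  ¬ ∃ (c : ℝ) (F : (Fin 1 → ℝ) → ℝ),
      Literature.NumberTheory.Transcendental.IsSemialgebraicFunOn ℚ {x | x 0 ∈ Icc (0 : ℝ) 1} F ∧
      ∀ t ∈ Ioo (0 : ℝ) 1,
        HasDerivAt (fun s : ℝ => F (fun _ => s)) (2 * t / (2 - t ^ 2) - 1 / (2 - t) + c) t

/-- `f(t) = 2t/(2 − t²) − 1/(2 − t)` is a kernel element:
`∫₀¹ f = [log (2 − t) − log (2 − t²)]₀¹ = (0 − 0) − (log 2 − log 2) = 0` (FTC with the transcendental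
primitive); inside the KZ rules this is the change of variables `t ↦ t²` applied to `∫₀¹ dt/(2 − t)`.
[cite: Fresan2024, Rem. 3.7] -/
theorem integral_kernelElt_eq_zero :
    ∫ t in (0 : ℝ)..1, (2 * t / (2 - t ^ 2) - 1 / (2 - t)) = 0 := by
  have hderiv : ∀ x ∈ uIcc (0 : ℝ) 1,
      HasDerivAt (fun y : ℝ => Real.log (2 - y) - Real.log (2 - y * y))
        (2 * x / (2 - x ^ 2) - 1 / (2 - x)) x := by
    intro x hx
    rw [uIcc_of_le zero_le_one] at hx
    have h2 : (2 : ℝ) - x ≠ 0 := by have := hx.2; intro h; linarith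
    have h1 : (2 : ℝ) - x * x ≠ 0 := by have := hx.1; have := hx.2; intro h; nlinarith
    have hA : HasDerivAt (fun y : ℝ => Real.log (2 - y)) ((-1) / (2 - x)) x :=
      ((hasDerivAt_id x).const_sub 2).log h2
    have hB : HasDerivAt (fun y : ℝ => Real.log (2 - y * y))
        ((-(1 * x + x * 1)) / (2 - x * x)) x :=
      (((hasDerivAt_id x).mul (hasDerivAt_id x)).const_sub 2).log h1
    refine (hA.sub hB).congr_deriv ?_
    have h1' : (2 : ℝ) - x ^ 2 ≠ 0 := by rw [pow_two]; exact h1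
    field_simp
    ring
  have hint : IntervalIntegrable (fun t : ℝ => 2 * t / (2 - t ^ 2) - 1 / (2 - t)) volume 0 1 := by
    apply ContinuousOn.intervalIntegrable
    rw [uIcc_of_le zero_le_one]
    apply ContinuousOn.sub
    · apply ContinuousOn.div (continuousOn_const.mul continuousOn_id)
        (continuousOn_const.sub (continuousOn_id.pow 2))
      intro x hx h
      have : 0 ≤ x := hx.1
      have : x ≤ 1 := hx.2
      have : (2 : ℝ) - x ^ 2 = 0 := h
      nlinarith
    · apply ContinuousOn.div continuousOn_const (continuousOn_const.sub continuousOn_id)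
      intro x hx h
      have : x ≤ 1 := hx.2
      have : (2 : ℝ) - x = 0 := h
      linarith
  rw [integral_eq_sub_of_hasDerivAt hderiv hint]
  norm_num

namespace NoSemialgPrimKernel

open Polynomial
open scoped Polynomial.Bivariate

/-- Steps (A)+(B) packaged: a `ℚ`-semialgebraic function of one variable on `[0,1]` satisfies a
non-trivial real polynomial relation. [folklore] -/
theorem exists_ne_zero_evalEval_eq_zero {F : (Fin 1 → ℝ) → ℝ}
    (hF : Literature.NumberTheory.Transcendental.IsSemialgebraicFunOn ℚ {x | x 0 ∈ Icc (0 : ℝ) 1} F) :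
    ∃ P : ℝ[X][Y], P ≠ 0 ∧ ∀ t ∈ Icc (0 : ℝ) 1, P.evalEval t (F fun _ => t) = 0 := by
  set Γ : Set (Fin 2 → ℝ) :=
    {z | ∃ x ∈ {x : Fin 1 → ℝ | x 0 ∈ Icc (0 : ℝ) 1}, z = Fin.snoc x (F x)} with hΓ
  have hΓ' : Literature.ModelTheory.ExponentialFields.IsSemialgebraic ℚ Γ := hF
  obtain ⟨q, hq0, hopen, -⟩ := NoSemialgPrim.exists_ne_zero_isOpen hΓ'
  have hvan : ∀ z ∈ Γ, MvPolynomial.eval z q = 0 := by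
    intro z hz
    by_contra hne
    obtain ⟨ε, hε, hball⟩ := Metric.isOpen_iff.mp hopen z ⟨hz, hne⟩
    obtain ⟨x, hx, rfl⟩ := hz
    have hmem : (Fin.snoc x (F x + ε / 2) : Fin 2 → ℝ) ∈
        Metric.ball (Fin.snoc x (F x) : Fin 2 → ℝ) ε := by
      rw [Metric.mem_ball, dist_pi_lt_iff hε]
      intro i
      fin_cases i
      · simp [Fin.snoc, hε]
      · simp [Fin.snoc, abs_of_pos hε, half_lt_self hε]
    obtain ⟨⟨x', -, hxx'⟩, -⟩ := hball hmem
    have h0 : x = x' := by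
      funext j
      fin_cases j
      simpa [Fin.snoc] using congrFun hxx' 0
    have h1 := congrFun hxx' 1
    simp only [Fin.snoc] at h1
    simp [← h0] at h1
    exact absurd h1 hε.ne'
  refine ⟨(Polynomial.Bivariate.equivMvPolynomial ℝ).symm q, by simpa using hq0, ?_⟩
  intro t ht
  have hz : (Fin.snoc (fun _ : Fin 1 => t) (F fun _ => t) : Fin 2 → ℝ) ∈ Γ :=
    ⟨fun _ => t, ht, rfl⟩
  have h := hvan _ hz
  rw [← NoSemialgPrim.evalEval_equivMvPolynomial_symm] at h
  simpa [Fin.snoc] using h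

/-- **Step (D), core, with a unit `V` and a numerator `N`.** [folklore] -/
theorem core_ne_zero (u V N a b : ℝ[X]) (x₀ : ℝ) (hu0 : u ≠ 0) (hu2 : u.eval x₀ = 0) (m r d : ℕ)
    (hV : V.eval x₀ ≠ 0) (hN : N.eval x₀ ≠ 0)
    (ha : a.eval x₀ ≠ 0) (hb : b.eval x₀ ≠ 0) (hd : (d : ℝ) ≠ 0) :
    u ^ (m + r) * (V * ((C (r : ℝ) - C (m : ℝ)) * a * b + u * (a * derivative b - derivative a * b)))
      + C (d : ℝ) * N * u ^ (2 * m) * a ^ 2 ≠ 0 := by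
  intro H
  rcases lt_trichotomy r m with h | rfl | h
  · obtain ⟨e, rfl⟩ := Nat.exists_eq_add_of_lt h
    have hW : u ^ (r + e + 1 + r) *
        (V * ((C (r : ℝ) - C ((r + e + 1 : ℕ) : ℝ)) * a * b + u * (a * derivative b - derivative a * b))
          + C (d : ℝ) * N * u ^ (e + 1) * a ^ 2) = 0 := by
      linear_combination H
    have hW' := (mul_eq_zero.mp hW).resolve_left (pow_ne_zero _ hu0)
    have h2 := congrArg (Polynomial.eval x₀) hW'
    simp only [eval_add, eval_mul, eval_sub, eval_C, eval_pow, hu2, zero_mul, add_zero,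
      zero_pow (Nat.succ_ne_zero e), mul_zero, eval_zero] at h2
    have hcoef : ((r : ℝ) - ((r + e + 1 : ℕ) : ℝ)) ≠ 0 := by
      push_cast
      linarith
    exact mul_ne_zero hV (mul_ne_zero (mul_ne_zero hcoef ha) hb) h2
  · have hW : u ^ (2 * r) * (V * (u * (a * derivative b - derivative a * b)) + C (d : ℝ) * N * a ^ 2) = 0 := by
      linear_combination H
    have hW' := (mul_eq_zero.mp hW).resolve_left (pow_ne_zero _ hu0)
    have h2 := congrArg (Polynomial.eval x₀) hW'
    simp only [eval_add, eval_mul, eval_sub, eval_C, eval_pow, hu2, zero_mul, zero_add, mul_zero,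
      eval_zero] at h2
    exact mul_ne_zero (mul_ne_zero hd hN) (pow_ne_zero 2 ha) h2
  · obtain ⟨e, rfl⟩ := Nat.exists_eq_add_of_lt h
    have hW : u ^ (2 * m) * (u ^ (e + 1) *
        (V * ((C ((m + e + 1 : ℕ) : ℝ) - C (m : ℝ)) * a * b + u * (a * derivative b - derivative a * b)))
          + C (d : ℝ) * N * a ^ 2) = 0 := by
      linear_combination H
    have hW' := (mul_eq_zero.mp hW).resolve_left (pow_ne_zero _ hu0)
    have h2 := congrArg (Polynomial.eval x₀) hW'
    simp only [eval_add, eval_mul, eval_sub, eval_C, eval_pow, hu2, zero_mul, zero_add,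
      zero_pow (Nat.succ_ne_zero e), eval_zero] at h2
    exact mul_ne_zero (mul_ne_zero hd hN) (pow_ne_zero 2 ha) h2

/-- **Step (D) with unit and numerator.** For `p ≠ 0`, `d ≠ 0`, `V(x₀) N(x₀) ≠ 0`:
`(X − x₀) V (p q' − p' q) + d N p² ≠ 0` — no function algebraic of degree `d` over `ℝ(X)` has
derivative `N/((X − x₀) V)` with a non-zero residue at `x₀`. [folklore] -/
theorem coeff_identity_ne_zero (p q V N : ℝ[X]) (x₀ : ℝ) (d : ℕ) (hd : d ≠ 0) (hp : p ≠ 0)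
    (hV : V.eval x₀ ≠ 0) (hN : N.eval x₀ ≠ 0) :
    (X - C x₀) * V * (p * derivative q - derivative p * q) + C (d : ℝ) * N * p ^ 2 ≠ 0 := by
  intro E
  have hdR : (d : ℝ) ≠ 0 := Nat.cast_ne_zero.mpr hd
  have hN0 : N ≠ 0 := by
    rintro rfl
    exact hN (by simp)
  by_cases hq : q = 0
  · subst hq
    simp only [derivative_zero, mul_zero, zero_sub, neg_zero, zero_add] at E
    rcases mul_eq_zero.mp E with h | h
    · rcases mul_eq_zero.mp h with h' | h'
      · exact hdR (C_eq_zero.mp h')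
      · exact hN0 h'
    · exact hp (pow_eq_zero_iff (two_ne_zero) |>.mp h)
  obtain ⟨a, hpa, hna⟩ := p.exists_eq_pow_rootMultiplicity_mul_and_not_dvd hp x₀
  obtain ⟨b, hqb, hnb⟩ := q.exists_eq_pow_rootMultiplicity_mul_and_not_dvd hq x₀
  have ha : a.eval x₀ ≠ 0 := fun h => hna (dvd_iff_isRoot.mpr h)
  have hb : b.eval x₀ ≠ 0 := fun h => hnb (dvd_iff_isRoot.mpr h)
  set m := p.rootMultiplicity x₀ with hm
  set r := q.rootMultiplicity x₀ with hr
  set u : ℝ[X] := X - C x₀ with hu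
  have hu0 : u ≠ 0 := X_sub_C_ne_zero x₀
  have hu1 : derivative u = 1 := derivative_X_sub_C x₀
  have hu2 : u.eval x₀ = 0 := by simp [hu]
  have hp' : u * derivative p = u ^ m * (C (m : ℝ) * a + u * derivative a) := by
    rw [hpa]; exact NoSemialgPrim.mul_derivative_pow_mul u a hu1 m
  have hq' : u * derivative q = u ^ r * (C (r : ℝ) * b + u * derivative b) := by
    rw [hqb]; exact NoSemialgPrim.mul_derivative_pow_mul u b hu1 r
  have E2 : V * (p * (u * derivative q) - (u * derivative p) * q) + C (d : ℝ) * N * p ^ 2 = 0 := by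
    linear_combination E
  rw [hp', hq'] at E2
  rw [hpa, hqb] at E2
  exact core_ne_zero u V N a b x₀ hu0 hu2 m r d hV hN ha hb hdR (by linear_combination E2)

/-- **Step (C), analytic input, general derivative.** If `G' = g'` on `(0, 1)` with
`D(t) g'(t) = N(t)` and `∑ⱼ pⱼ(s) G(s)ʲ = 0` on `(0, 1)`, then
`∑ⱼ (D pⱼ' Gʲ + j N pⱼ Gʲ⁻¹) = 0` there. [folklore] -/
theorem sum_deriv_eq_zero {G g' : ℝ → ℝ} {D N : ℝ[X]}
    (hG : ∀ t ∈ Ioo (0:ℝ) 1, HasDerivAt G (g' t) t)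
    (hDN : ∀ t ∈ Ioo (0:ℝ) 1, D.eval t * g' t = N.eval t)
    (M : ℕ) (p : ℕ → ℝ[X])
    (hv : ∀ s ∈ Ioo (0:ℝ) 1, ∑ j ∈ Finset.range M, (p j).eval s * G s ^ j = 0)
    {t : ℝ} (ht : t ∈ Ioo (0:ℝ) 1) :
    ∑ j ∈ Finset.range M,
      (D.eval t * (derivative (p j)).eval t * G t ^ j
        + (j : ℝ) * N.eval t * (p j).eval t * G t ^ (j - 1)) = 0 := by
  have hf : HasDerivAt (fun s => ∑ j ∈ Finset.range M, (p j).eval s * G s ^ j)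
      (∑ j ∈ Finset.range M, ((derivative (p j)).eval t * G t ^ j +
        (p j).eval t * ((j : ℝ) * G t ^ (j - 1) * g' t))) t :=
    HasDerivAt.fun_sum fun j _ => ((p j).hasDerivAt t).mul ((hG t ht).pow j)
  have h0 : HasDerivAt (fun s => ∑ j ∈ Finset.range M, (p j).eval s * G s ^ j) 0 t := by
    apply (hasDerivAt_const t (0:ℝ)).congr_of_eventuallyEq
    filter_upwards [Ioo_mem_nhds ht.1 ht.2] with s hs
    exact hv s hs
  have hsum := hf.unique h0
  calc ∑ j ∈ Finset.range M,
        (D.eval t * (derivative (p j)).eval t * G t ^ j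
          + (j : ℝ) * N.eval t * (p j).eval t * G t ^ (j - 1))
      = D.eval t * ∑ j ∈ Finset.range M, ((derivative (p j)).eval t * G t ^ j +
          (p j).eval t * ((j : ℝ) * G t ^ (j - 1) * g' t)) := by
        rw [Finset.mul_sum]
        refine Finset.sum_congr rfl fun j _ => ?_
        rw [← hDN t ht]
        ring
    _ = 0 := by rw [hsum, mul_zero]

/-- **Step (C), general simple pole.** A function whose derivative on `(0, 1)` is
`N / ((X − x₀) V)` with `V(x₀) N(x₀) ≠ 0` satisfies no non-trivial polynomial relation
`P(t, G t) = 0` on `(0, 1)`. [folklore] -/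
theorem eq_zero_of_evalEval_eq_zero {G g' : ℝ → ℝ} {V N : ℝ[X]} {x₀ : ℝ}
    (hG : ∀ t ∈ Ioo (0:ℝ) 1, HasDerivAt G (g' t) t)
    (hDN : ∀ t ∈ Ioo (0:ℝ) 1, ((X - C x₀) * V).eval t * g' t = N.eval t)
    (hV : V.eval x₀ ≠ 0) (hN : N.eval x₀ ≠ 0) :
    ∀ (n : ℕ) (P : ℝ[X][Y]), P.natDegree ≤ n →
      (∀ t ∈ Ioo (0:ℝ) 1, P.evalEval t (G t) = 0) → P = 0 := by
  intro n
  induction n with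
  | zero =>
    intro P hP hv
    have hPC : P = C (P.coeff 0) := eq_C_of_natDegree_le_zero hP
    have h0 : P.coeff 0 = 0 := by
      apply Polynomial.eq_zero_of_infinite_isRoot
      refine Set.Infinite.mono ?_ (Set.Ioo_infinite (zero_lt_one' ℝ))
      intro t ht
      have := hv t ht
      rw [hPC, evalEval_C] at this
      exact this
    rw [hPC, h0, map_zero]
  | succ n ih =>
    intro P hP hv
    by_cases hd : P.natDegree ≤ n
    · exact ih P hd hv
    have hdeg : P.natDegree = n + 1 := by omega
    by_contra hP0
    have hlead : P.coeff (n + 1) ≠ 0 := by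
      rw [← hdeg]
      exact leadingCoeff_ne_zero.mpr hP0
    set D : ℝ[X] := (X - C x₀) * V with hD_def
    set p : ℕ → ℝ[X] := fun j => P.coeff j with hp_def
    set Q₁ : ℝ[X][Y] := ∑ j ∈ Finset.range (n + 2), C (D * derivative (p j)) * Y ^ j with hQ₁
    set Q₂ : ℝ[X][Y] :=
      ∑ j ∈ Finset.range (n + 1), C (C ((j : ℝ) + 1) * N * p (j + 1)) * Y ^ j with hQ₂
    set R : ℝ[X][Y] := C (p (n + 1)) * (Q₁ + Q₂) - C (D * derivative (p (n + 1))) * P with hR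
    have hPsum : P = ∑ j ∈ Finset.range (n + 2), C (p j) * Y ^ j := by
      have := P.as_sum_range_C_mul_X_pow
      rw [hdeg] at this
      exact this
    have hfP : ∀ s, P.evalEval s (G s) = ∑ j ∈ Finset.range (n + 2), (p j).eval s * G s ^ j := by
      intro s
      conv_lhs => rw [hPsum]
      simp [evalEval_finsetSum, evalEval_C]
    have hv' : ∀ s ∈ Ioo (0:ℝ) 1, ∑ j ∈ Finset.range (n + 2), (p j).eval s * G s ^ j = 0 :=
      fun s hs => (hfP s) ▸ hv s hs
    have hQ : ∀ t ∈ Ioo (0:ℝ) 1, (Q₁ + Q₂).evalEval t (G t) = 0 := by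
      intro t ht
      have key := sum_deriv_eq_zero hG hDN (n + 2) p hv' ht
      rw [Finset.sum_add_distrib,
        Finset.sum_range_succ' (fun j => (j : ℝ) * N.eval t * (p j).eval t * G t ^ (j - 1))] at key
      simp only [Nat.cast_zero, zero_mul, add_zero, Nat.add_sub_cancel, Nat.cast_succ] at key
      have e1 : Q₁.evalEval t (G t) =
          ∑ j ∈ Finset.range (n + 2), D.eval t * (derivative (p j)).eval t * G t ^ j := by
        simp only [hQ₁, evalEval_finsetSum, evalEval_mul, evalEval_C, evalEval_pow, evalEval_X,
          eval_mul]
      have e2 : Q₂.evalEval t (G t) =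
          ∑ j ∈ Finset.range (n + 1), ((j : ℝ) + 1) * N.eval t * (p (j + 1)).eval t * G t ^ j := by
        simp only [hQ₂, evalEval_finsetSum, evalEval_mul, evalEval_C, evalEval_pow, evalEval_X,
          eval_mul, eval_C]
      rw [evalEval_add, e1, e2]
      exact key
    have hvR : ∀ t ∈ Ioo (0:ℝ) 1, R.evalEval t (G t) = 0 := by
      intro t ht
      simp only [hR, evalEval_sub, evalEval_mul, evalEval_C, hQ t ht, hv t ht, mul_zero, sub_zero]
    have hcQ₁ : ∀ k, Q₁.coeff k = if k < n + 2 then D * derivative (p k) else 0 := fun k => by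
      rw [hQ₁]; exact NoSemialgPrim.coeff_sum_C_mul_X_pow (fun j => D * derivative (p j)) (n + 2) k
    have hcQ₂ : ∀ k, Q₂.coeff k = if k < n + 1 then C ((k : ℝ) + 1) * N * p (k + 1) else 0 :=
      fun k => by
      rw [hQ₂]
      exact NoSemialgPrim.coeff_sum_C_mul_X_pow (fun j => C ((j : ℝ) + 1) * N * p (j + 1)) (n + 1) k
    have hcR : ∀ k, R.coeff k = p (n + 1) * (Q₁.coeff k + Q₂.coeff k) -
        D * derivative (p (n + 1)) * P.coeff k := fun k => by
      simp only [hR, coeff_sub, coeff_C_mul, coeff_add]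
    have hRdeg : R.natDegree ≤ n := by
      rw [Polynomial.natDegree_le_iff_coeff_eq_zero]
      intro M hM
      rw [hcR, hcQ₁, hcQ₂]
      rcases Nat.lt_or_ge M (n + 2) with h | h
      · have hM1 : M = n + 1 := by omega
        subst hM1
        simp only [show n + 1 < n + 2 by omega, if_true, lt_irrefl, if_false, add_zero]
        simp only [hp_def]
        ring
      · have hPM : P.coeff M = 0 := coeff_eq_zero_of_natDegree_lt (by omega)
        simp only [show ¬ (M < n + 2) by omega, show ¬ (M < n + 1) by omega, if_false, add_zero,
          mul_zero, hPM, sub_zero]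
    have hR0 : R = 0 := ih R hRdeg hvR
    have hcoef := hcR n
    rw [hR0, coeff_zero, hcQ₁, hcQ₂] at hcoef
    simp only [show n < n + 2 by omega, show n < n + 1 by omega, if_true] at hcoef
    apply coeff_identity_ne_zero (p (n + 1)) (p n) V N x₀ (n + 1) (Nat.succ_ne_zero n) hlead hV hN
    rw [hD_def] at hcoef
    have : (((n + 1 : ℕ) : ℝ)) = (n : ℝ) + 1 := by push_cast; ring
    rw [this]
    linear_combination -hcoef

end NoSemialgPrimKernel

open Polynomial in
open scoped Polynomial.Bivariate in
/-- **The NARROW barrier fact holds**: for no constant `c` does `2t/(2 − t²) − 1/(2 − t) + c` have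
a `ℚ`-semialgebraic primitive on `[0, 1]` (steps (A)–(B) of the module docstring, then the general
simple-pole descent `NoSemialgPrimKernel.eq_zero_of_evalEval_eq_zero` with `x₀ = 2`, `V = X² − 2`,
`N = −2X(X − 2) + (X² − 2) + c (X − 2)(X² − 2)`). [cite: Ayoub2015, Rem. 1.2] [cite: Fresan2024, Rem. 3.6] -/
theorem algebraicPrimitivesObstructionNarrow_holds : algebraicPrimitivesObstructionNarrow := by
  rintro ⟨c, F, hF, hderiv⟩
  obtain ⟨P, hP0, hPv⟩ := NoSemialgPrimKernel.exists_ne_zero_evalEval_eq_zero hF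
  have hV : (X ^ 2 - C (2 : ℝ) : ℝ[X]).eval 2 ≠ 0 := by norm_num
  have hN : (-(C (2 : ℝ) * X * (X - C 2)) + (X ^ 2 - C 2) + C c * (X - C 2) * (X ^ 2 - C 2) :
      ℝ[X]).eval 2 ≠ 0 := by
    norm_num
  have hDN : ∀ t ∈ Ioo (0 : ℝ) 1,
      ((X - C (2 : ℝ)) * (X ^ 2 - C 2)).eval t * (2 * t / (2 - t ^ 2) - 1 / (2 - t) + c)
        = (-(C (2 : ℝ) * X * (X - C 2)) + (X ^ 2 - C 2) + C c * (X - C 2) * (X ^ 2 - C 2) :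
            ℝ[X]).eval t := by
    intro t ht
    have h2 : (2 : ℝ) - t ≠ 0 := by have := ht.2; intro h; linarith
    have h1 : (2 : ℝ) - t ^ 2 ≠ 0 := by have := ht.1; have := ht.2; intro h; nlinarith
    simp only [eval_mul, eval_add, eval_sub, eval_neg, eval_pow, eval_X, eval_C]
    field_simp
    ring
  exact hP0 (NoSemialgPrimKernel.eq_zero_of_evalEval_eq_zero (G := fun s : ℝ => F fun _ => s)
    hderiv hDN hV hN P.natDegree P le_rfl (fun t ht => hPv t (Ioo_subset_Icc_self ht)))

/-- **Level `n = 1` of the variable count.** The kernel element `2t/(2 − t²) − 1/(2 − t)` is not a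
one-variable Stokes element: there is no `ℚ`-semialgebraic `g` on `[0, 1]`, differentiable on
`(0, 1)`, with `g' − (g(1) − g(0)) = 2t/(2 − t²) − 1/(2 − t)` there — Conjecture 1.1 with the `g`'s
confined to as many variables as `f` fails already at one variable, while two variables suffice for
this `f` [cite: Ayoub2015, Rem. 1.5] [cite: Fresan2024, Rem. 3.7]. (`ℚ̄`-linear combinations of
Stokes elements `Σ aᵢ S(gᵢ) = S(Σ aᵢ gᵢ)` reduce to a single `g` by linearity.) -/
theorem kernelElt_not_stokes_one_variable :
    ¬ ∃ (g : (Fin 1 → ℝ) → ℝ) (g' : ℝ → ℝ),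
      Literature.NumberTheory.Transcendental.IsSemialgebraicFunOn ℚ {x | x 0 ∈ Icc (0 : ℝ) 1} g ∧
      (∀ t ∈ Ioo (0 : ℝ) 1, HasDerivAt (fun s : ℝ => g (fun _ => s)) (g' t) t) ∧
      ∀ t ∈ Ioo (0 : ℝ) 1,
        g' t - (g (fun _ => 1) - g (fun _ => 0)) = 2 * t / (2 - t ^ 2) - 1 / (2 - t) := by
  rintro ⟨g, g', hg, hderiv, hstokes⟩
  refine algebraicPrimitivesObstructionNarrow_holds ⟨g (fun _ => 1) - g (fun _ => 0), g, hg, ?_⟩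
  intro t ht
  refine (hderiv t ht).congr_deriv ?_
  have := hstokes t ht
  linarith

end Literature.Barriers.KontsevichZagierPeriods.KZ
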